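import Literature.AlgebraicGeometry.HodgeTheory.BertiniFiniteMorphism
import Literature.AlgebraicGeometry.HodgeTheory.FiniteMorphismHyperplaneSections
import Literature.AlgebraicGeometry.Motives.InvariantFiniteMorphism
import Literature.AlgebraicGeometry.Hyperkaehler.K3HilbertSquareTypeNonsymplecticOrder23
import HarnessLib

/-!
# Smooth hyperplane sections STABLE under an automorphism of finite order (equivariant Bertini),
# and the stable threefold sections of the Boissière–Camere–Mongardi–Sarti fourfold

Topic `Literature/AlgebraicGeometry/HodgeTheory` (theorems only; no definitions, no named facts).

**Equivariant Bertini.** Let `X` be a smooth projective complex variety of dimension `n + 1 ≥ 2`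
and `f` an automorphism of `X` of finite order `m`. The classical argument (Mumford, *Abelian
Varieties* §7: the sections `∏_{g} g^*F` are invariant and base-point free, so they define a FINITE
invariant morphism `φ : X → ℙᴸ`, through `X/⟨f⟩`; Hartshorne III Cor. 10.9 with Rem. 10.9.1 and
III Cor. 7.9: the general member of a base-point-free ample linear system on a smooth projective
variety is smooth and irreducible) gives smooth `f`-STABLE hypersurface sections `Y = φ⁻¹(H) ⊂ X`,
and the Lefschetz hyperplane theorem holds for them since `X ∖ Y = φ⁻¹(ℙᴸ ∖ H)` is affine
(Lazarsfeld, *Positivity* I, Thm. 3.1.1 / Rem. 3.1.2). Assembled here from the tree: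

* `Motives.exists_isFinite_comp_eq_of_pow_eq_one` (`Motives/InvariantFiniteMorphism`): a finite
  `φ : X ⟶ ℙᴸ_ℂ` with `f ≫ φ = φ` (norm map of `fⁱ ≫ ι`);
* the NAMED FACT `Hartshorne1977_bertini_finiteMorphism` (`HodgeTheory/BertiniFiniteMorphism`), taken
  as a hypothesis `(h : Hartshorne1977_bertini_finiteMorphism)`: the very general member
  `Y_s = φ⁻¹(H_s)` is smooth projective of dimension `n`;
* `FiniteMorphismSection.*` (`HodgeTheory/FiniteMorphismHyperplaneSections`): `Y_s ⟶ X` is a closed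
  immersion, weak Lefschetz (`Hᵏ(X) ⥲ Hᵏ(Y_s)` for `k < n`, injective for `k = n`), and the
  restriction `g_s : Y_s ⟶ Y_s` of `f`, of order dividing `m`.

Result: `eventually_smooth_stable_section` (for all `s` in a residual subset of `(ℙᴸ)^*(ℂ)`) and
`exists_smooth_stable_section`.

**The BCMS instance** (cell `hodge-nonav`, planner route memo ROUTE-P1X, chapter EXT, row EX11:
smooth projective THREEFOLDS `Y` with `h^{2,0}(Y) = 1` and an automorphism of finite order `m` on
`T²(Y)` with `φ(m) = dim T²(Y)_ℚ`; LIT-DOSSIER §65: the known instances are one Lefschetz step away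
from hyperkähler fourfolds with a non-symplectic automorphism). Granted in addition the NAMED FACT
`Hyperkaehler.BCMS2016_K3HilbertSquareType_nonsymplecticAutomorphism_order23` (Boissière–Camere–
Mongardi–Sarti 2016, Thm. 1.1: a `K3^[2]`-type fourfold `X` with an automorphism `f` of order `23`,
`ρ(X) = 1`, `f^*` of order `23` on `H²` with `Inv(f) = NS(X)`):
`BCMS2016_….exists_stable_threefold_section` — there is a smooth projective THREEFOLD `Y ↪ X`,
stable under `f`, with `g = f|_Y` of order dividing `23`, `ι^* : H²(X(ℂ); ℂ) ⥲ H²(Y(ℂ); ℂ)`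
(and `Hᵏ`, `k ≤ 2`) bijective and `g`-equivariant, `H³(X) → H³(Y)` injective, `b₂(Y) = 23`; all the
printed properties of `(X, f)` are carried along. The Hodge-theoretic transfer (`h^{2,0}(Y) = 1`,
`ρ(Y) = 1`, the eigenvalues of `g^*` on `T²(Y)`) is the Lefschetz-transfer step of the route memo
(compatibility of `ι^*` with Hodge types, `IsOfHodgeType.map_of_isSmoothProjective`) and is NOT done
here.

## References

* [Hartshorne1977] R. Hartshorne, *Algebraic Geometry*, III Cor. 10.9, Rem. 10.9.1, III Cor. 7.9.
* [MumfordAV1970] D. Mumford, *Abelian Varieties*, §7 Thm. p. 66 and Remark p. 69.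
* [Lazarsfeld2004PositivityI] R. Lazarsfeld, *Positivity in Algebraic Geometry I*, Thm. 3.1.1,
  Rem. 3.1.2.
* [BoissiereCamereMongardiSarti2016] S. Boissière, C. Camere, G. Mongardi, A. Sarti, IMRN 2016,
  Thm. 1.1 = Thm. 6.1.
-/

noncomputable section

open CategoryTheory AlgebraicGeometry Filter Topology
open Literature.AlgebraicGeometry.Motives Literature.AlgebraicGeometry.Motives.UniversalHyperplaneSection

namespace Literature.AlgebraicGeometry.HodgeTheory

/-! ### §1 Equivariant Bertini -/

/-- **Equivariant Bertini (very general form).** Granted Bertini for finite morphisms: for `X` smooth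
projective over `ℂ` of dimension `n + 1 ≥ 2` and `f : X ⟶ X` with `fᵐ = 1` (`m ≥ 1`), there is a
finite `f`-invariant `φ : X ⟶ ℙᴸ_ℂ` such that for all `s` in a residual subset of `(ℙᴸ)^*(ℂ)` the
member `Y_s = φ⁻¹(H_s)` is a smooth projective variety of dimension `n`, `ι_s : Y_s ⟶ X` is a closed
immersion with `Hᵏ(X(ℂ); ℂ) → Hᵏ(Y_s(ℂ); ℂ)` bijective for `k < n` and injective for `k = n`, and
`f` restricts to `g_s : Y_s ⟶ Y_s` (`g_s ≫ ι_s = ι_s ≫ f`) with `g_sᵐ = 1`.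
[cite: Hartshorne1977, III Cor. 10.9 and Rem. 10.9.1] [cite: MumfordAV1970, §7 Thm. p. 66 and Remark p. 69] [cite: Lazarsfeld2004PositivityI, Thm. 3.1.1 and Rem. 3.1.2] -/
theorem eventually_smooth_stable_section (h : Hartshorne1977_bertini_finiteMorphism) {n : ℕ}
    {X : SchemeOver ℂ} (hX : IsSmoothProjective (n + 1) X) (hn : 1 ≤ n) (f : X ⟶ X) {m : ℕ}
    (hm : 0 < m) (hf : End.of f ^ m = 1) :
    ∃ (L : ℕ) (φ : X ⟶ projectiveSpace L ℂ), IsFinite φ.left ∧ f ≫ φ = φ ∧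
      ∀ᶠ s in residual (ComplexPoints (dualProjectiveSpace L ℂ)),
        IsSmoothProjective n (fiberOver (proj L φ) s) ∧
        IsClosedImmersion (fiberι (proj L φ) s ≫ toX L φ).left ∧
        (∀ k < n, Function.Bijective (complexBetti.map (fiberι (proj L φ) s ≫ toX L φ) k)) ∧
        Function.Injective (complexBetti.map (fiberι (proj L φ) s ≫ toX L φ) n) ∧
        ∃ g : fiberOver (proj L φ) s ⟶ fiberOver (proj L φ) s,
          g ≫ (fiberι (proj L φ) s ≫ toX L φ) = (fiberι (proj L φ) s ≫ toX L φ) ≫ f ∧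
            End.of g ^ m = 1 := by
  obtain ⟨L, φ, hfin, hinv⟩ := hX.exists_isFinite_comp_eq_of_pow_eq_one f hm hf
  refine ⟨L, φ, hfin, hinv, ?_⟩
  haveI := hfin
  haveI : LocallyOfFiniteType X.hom := locallyOfFiniteType_of_isSmoothProjective hX
  filter_upwards [h.eventually_residual_mem_universalSmoothLocus hX hn φ] with s hs
  exact ⟨hs, FiniteMorphismSection.isClosedImmersion_fiberι_toX_left φ s,
    fun k hk ↦ FiniteMorphismSection.bijective_complexBettiMap_fiberι_toX_of_lt φ s hX hs hk,
    FiniteMorphismSection.injective_complexBettiMap_fiberι_toX φ s hX hs le_rfl,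
    FiniteMorphismSection.exists_restrict_fiberOver_pow_eq_one φ s f hinv hf⟩

/-- **Equivariant Bertini (existence form).** Granted Bertini for finite morphisms: a smooth
projective complex variety `X` of dimension `n + 1 ≥ 2` with an automorphism `f` of finite order
`m` has a smooth projective closed subvariety `ι : Y ↪ X` of dimension `n`, STABLE under `f`
(`g ≫ ι = ι ≫ f`, `gᵐ = 1`), with `Hᵏ(X(ℂ); ℂ) → Hᵏ(Y(ℂ); ℂ)` bijective for `k < n` and injective
for `k = n` — a general member of the base-point-free ample system of `f`-invariant sections.
[cite: Hartshorne1977, III Cor. 10.9 and Rem. 10.9.1] [cite: MumfordAV1970, §7 Thm. p. 66 and Remark p. 69] [cite: Lazarsfeld2004PositivityI, Thm. 3.1.1 and Rem. 3.1.2] -/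
theorem exists_smooth_stable_section (h : Hartshorne1977_bertini_finiteMorphism) {n : ℕ}
    {X : SchemeOver ℂ} (hX : IsSmoothProjective (n + 1) X) (hn : 1 ≤ n) (f : X ⟶ X) {m : ℕ}
    (hm : 0 < m) (hf : End.of f ^ m = 1) :
    ∃ (Y : SchemeOver ℂ) (ι : Y ⟶ X) (g : Y ⟶ Y), IsSmoothProjective n Y ∧
      IsClosedImmersion ι.left ∧ g ≫ ι = ι ≫ f ∧ End.of g ^ m = 1 ∧
      (∀ k < n, Function.Bijective (complexBetti.map ι k)) ∧
      Function.Injective (complexBetti.map ι n) := by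
  obtain ⟨L, φ, -, -, hev⟩ := eventually_smooth_stable_section h hX hn f hm hf
  haveI := residual_dualProjectiveSpace_neBot L
  obtain ⟨s, hY, hcl, hbij, hinj, g, hg, hgm⟩ := hev.exists
  exact ⟨_, _, g, hY, hcl, hg, hgm, hbij, hinj⟩

/-- **Equivariant H² Lefschetz sections of fourfolds** — the consumer shape
`HodgeNonAV.P1Z.EquivariantH2LefschetzSection` of the cell's route memo ROUTE-P1Z (chapter L-SEC),
granted Bertini for finite morphisms: every smooth projective complex FOURFOLD `M` with `σ : M ⟶ M`,
`σᵏ = 1` (`k ≥ 1`), has a smooth projective THREEFOLD `ι : Y ⟶ M` stable under `σ`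
(`τ ≫ ι = ι ≫ σ`, `τᵏ = 1`) with `ι^* : H²(M(ℂ); ℂ) → H²(Y(ℂ); ℂ)` bijective.
[cite: Hartshorne1977, III Cor. 10.9 and Rem. 10.9.1] [cite: Lazarsfeld2004PositivityI, Thm. 3.1.1 and Rem. 3.1.2] -/
theorem equivariantH2LefschetzSection_of_bertini (h : Hartshorne1977_bertini_finiteMorphism)
    ⦃M : SchemeOver ℂ⦄ (hM : IsSmoothProjective 4 M) (σ : M ⟶ M) (k : ℕ) (hk : 1 ≤ k)
    (hσ : End.of σ ^ k = 1) :
    ∃ (Y : SchemeOver ℂ) (ι : Y ⟶ M) (τ : Y ⟶ Y), IsSmoothProjective 3 Y ∧ τ ≫ ι = ι ≫ σ ∧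
      End.of τ ^ k = 1 ∧ Function.Bijective (complexBetti.map ι (2 * 1)) := by
  obtain ⟨Y, ι, τ, hY, -, hτ, hτk, hbij, -⟩ :=
    exists_smooth_stable_section h (n := 3) hM (by norm_num) σ hk hσ
  exact ⟨Y, ι, τ, hY, hτ, hτk, hbij 2 (by norm_num)⟩

/-! ### §2 The stable threefold sections of the BCMS fourfold -/

/-- Cohomological equivariance of a restriction: `g ≫ ι = ι ≫ f` gives `f^* ≫ ι^* = ι^* ≫ g^*` on
`Hᵏ(–(ℂ); ℂ)`. [cite: VoisinHodgeII2003, §2.3.1] -/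
theorem complexBetti_map_comp_of_restrict {X Y : SchemeOver ℂ} (ι : Y ⟶ X) (g : Y ⟶ Y) (f : X ⟶ X)
    (hg : g ≫ ι = ι ≫ f) (k : ℕ) :
    complexBetti.map f k ≫ complexBetti.map ι k = complexBetti.map ι k ≫ complexBetti.map g k := by
  rw [← complexBetti.map_comp, ← complexBetti.map_comp, hg]

/-- **A smooth projective `f`-stable THREEFOLD section of the Boissière–Camere–Mongardi–Sarti
fourfold.** Granted the two named facts (BCMS 2016 Thm. 1.1; Bertini for finite morphisms): there
are a smooth projective complex fourfold `X` of `K3^[2]`-type with an automorphism `f` of order `23`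
having all the printed properties (`f^*` multiplies `H^{2,0}(X)` by a primitive `23`-rd root of
unity, `b₂(X) = 23`, `ρ(X) = 1`, `Inv(f^*) ⊗ ℂ = N¹H²(X(ℂ); ℂ)`, every primitive `23`-rd root of unity
an eigenvalue of `f^*` on `H²` of multiplicity one), AND a smooth projective threefold `Y` with a
closed immersion `ι : Y ⟶ X`, stable under `f` — `g ≫ ι = ι ≫ f` with `g²³ = 1` — such that
`ι^* : Hᵏ(X(ℂ); ℂ) → Hᵏ(Y(ℂ); ℂ)` is bijective for `k ≤ 2` and injective for `k = 3`, `f^* ≫ ι^* =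
ι^* ≫ g^*` on `H²`, and `b₂(Y) = 23`. (The Lefschetz transfer of the Hodge-theoretic data —
`h^{2,0}(Y) = 1`, `ρ(Y) = 1`, `g^*` of order `23` on `T²(Y)` of rank `22 = φ(23)` — is not done here.)
[cite: BoissiereCamereMongardiSarti2016, Thm. 1.1 and Thm. 6.1] [cite: Hartshorne1977, III Cor. 10.9 and Rem. 10.9.1] [cite: Lazarsfeld2004PositivityI, Thm. 3.1.1] -/
theorem _root_.Literature.AlgebraicGeometry.Hyperkaehler.BCMS2016_K3HilbertSquareType_nonsymplecticAutomorphism_order23.exists_stable_threefold_section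
    (hT : Hyperkaehler.BCMS2016_K3HilbertSquareType_nonsymplecticAutomorphism_order23)
    (h : Hartshorne1977_bertini_finiteMorphism) :
    ∃ (X : SchemeOver ℂ) (f : X ⟶ X) (Y : SchemeOver ℂ) (ι : Y ⟶ X) (g : Y ⟶ Y),
      (IsSmoothProjective 4 X ∧ Hyperkaehler.IsOfK3HilbertSquareType X ∧
        End.of f ^ 23 = 1 ∧ f ≠ 𝟙 X ∧
        (∃ ζ : ℂ, IsPrimitiveRoot ζ 23 ∧
          ∀ τ : complexBetti X 2, IsOfHodgeType 4 X 2 2 0 τ → complexBetti.map f 2 τ = ζ • τ) ∧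
        Module.finrank ℂ (complexBetti X 2) = 23 ∧
        Module.finrank ℂ (algebraicClasses X 1) = 1 ∧
        (∀ c : complexBetti X (2 * 1), complexBetti.map f (2 * 1) c = c ↔ c ∈ algebraicClasses X 1) ∧
        (∀ ζ : ℂ, IsPrimitiveRoot ζ 23 →
          Module.finrank ℂ (LinearMap.ker ((complexBetti.map f 2).hom - ζ • LinearMap.id)) = 1)) ∧
      IsSmoothProjective 3 Y ∧ IsClosedImmersion ι.left ∧ g ≫ ι = ι ≫ f ∧ End.of g ^ 23 = 1 ∧
      (∀ k ≤ 2, Function.Bijective (complexBetti.map ι k)) ∧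
      Function.Injective (complexBetti.map ι 3) ∧
      complexBetti.map f 2 ≫ complexBetti.map ι 2 = complexBetti.map ι 2 ≫ complexBetti.map g 2 ∧
      Module.finrank ℂ (complexBetti Y 2) = 23 := by
  obtain ⟨X, f, hX, hK3, h23, hne, hζ, hb2, hρ, hfix, hmult⟩ := hT
  obtain ⟨Y, ι, g, hY, hcl, hg, hgm, hbij, hinj⟩ :=
    exists_smooth_stable_section h (n := 3) hX (by norm_num) f (by norm_num) h23
  refine ⟨X, f, Y, ι, g, ⟨hX, hK3, h23, hne, hζ, hb2, hρ, hfix, hmult⟩, hY, hcl, hg, hgm,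
    fun k hk ↦ hbij k (by omega), hinj, complexBetti_map_comp_of_restrict ι g f hg 2, ?_⟩
  rw [← hb2]
  exact (LinearEquiv.ofBijective (complexBetti.map ι 2).hom (hbij 2 (by omega))).finrank_eq.symm

end Literature.AlgebraicGeometry.HodgeTheory

end
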